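import Summits.AtomisticToContinuum.Crystallization.Theses.NashClassCertificates
import Summits.AtomisticToContinuum.Crystallization.Theorems.ThreeConeCertificateOnePercentCertificateFccRung
import Summits.AtomisticToContinuum.Crystallization.Theorems.CoerciveTwoShellGap.Negative.Tolerance

/-!
# Crux `NashTwoShellGap` (stmt-AtomisticToContinuum-16826), line `bulk_dilute`: a CERTIFIED corner —
# every configuration of at most `18` points pays the explicit price `1/400` per bad particle

The first explicit positive price on a non-trivial class: for `N ≤ 18` EVERY particle is `1/20`-bad
(`CoerciveTwoShellGapNegative.bad_eq_of_le`: a two-shell witness needs `18` other particles), every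
configuration has `𝓔_LJ(x) ≥ −N(N−1)/24 ≥ −(17/24)·N` (`V_LJ ≥ −1/12` termwise, double counting), and the
tree's certified upper bound `e* ≤ −0.711` (`OnePercentFccRung.eStar_le_neg`, fcc lattice sum over twenty
shells) gives `N·e* + N/400 ≤ −0.7085·N ≤ −(17/24)·N`.  Hence (registered sub-goal `stub_smallClusterGap`)
`N·e* + (1/400)·#bad ≤ 𝓔_LJ(x)` for all `x : Fin N → ℝ³`, `N ≤ 18` — no separation, no injectivity, no Nash
hypothesis.  The margin is `0.711 − 1/400 − 17/24 ≈ 1.7·10⁻⁴` per particle; `N = 19` already needs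
`e* ≤ −3/4 + g`, false (`e* ≈ −0.7176`), so beyond `18` particles only genuine cluster energetics (or the
non-effective `stub_finiteCorner`) can serve.  No definitions; all `[folklore]`.
-/

noncomputable section

namespace Summit.AtomisticToContinuum.Crystallization.Theorems.NashTwoShellGapSmallClusterGap

open scoped BigOperators Classical
open Literature.MathematicalPhysics.StatisticalMechanics Literature.Geometry.DiscreteGeometry
open Summit.AtomisticToContinuum.Crystallization.Theorems.ChargedEnergyGapNegative (eStar E3)

/-- **`𝓔_LJ(x) ≥ −N(N−1)/24`** for every configuration of `N` points (each of the `N(N−1)` ordered pairs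
contributes `V_LJ ≥ −1/12` to `2𝓔`). [folklore] -/
theorem neg_le_interactionEnergy {N : ℕ} (x : Fin N → E3) :
    -((N : ℝ) * ((N : ℝ) - 1) / 24) ≤ interactionEnergy lennardJones x := by
  have h2 := two_mul_interactionEnergy lennardJones x
  have hsite : ∀ i : Fin N, -(((N : ℝ) - 1) / 12) ≤ siteEnergy lennardJones x i := by
    intro i
    unfold siteEnergy
    have hc : ((Finset.univ.erase i).card : ℝ) = (N : ℝ) - 1 := by
      rw [Finset.card_erase_of_mem (Finset.mem_univ i), Finset.card_univ, Fintype.card_fin,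
        Nat.cast_sub (Fin.pos i)]
      simp
    calc -(((N : ℝ) - 1) / 12) = ∑ _k ∈ Finset.univ.erase i, (-1 / 12 : ℝ) := by
          rw [Finset.sum_const, nsmul_eq_mul, hc]; ring
      _ ≤ ∑ k ∈ Finset.univ.erase i, lennardJones (dist (x i) (x k)) :=
          Finset.sum_le_sum fun k _ => neg_one_div_le_lennardJones _
  have hsum : ∑ _i : Fin N, (-(((N : ℝ) - 1) / 12)) ≤ ∑ i, siteEnergy lennardJones x i :=
    Finset.sum_le_sum fun i _ => hsite i
  rw [Finset.sum_const, Finset.card_univ, Fintype.card_fin, nsmul_eq_mul, ← h2] at hsum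
  linarith

/-- **Registered sub-goal `stub_smallClusterGap`** — the certified small-cluster corner of the crux: every
configuration of `N ≤ 18` points of `ℝ³` satisfies `N·e* + (1/400)·#bad ≤ 𝓔_LJ(x)` (all particles are bad;
`𝓔 ≥ −(17/24)N`; `e* ≤ −0.711`). [folklore] -/
theorem stub_smallClusterGap : ∀ (N : ℕ) (x : Fin N → EuclideanSpace ℝ (Fin 3)), N ≤ 18 → (N : ℝ) * (⨅ Q : Literature.MathematicalPhysics.StatisticalMechanics.PeriodicConfiguration 3, Q.energyPerParticle Literature.MathematicalPhysics.StatisticalMechanics.lennardJones) + (1 / 400) * (Nat.card {i : Fin N // ¬ Literature.Geometry.DiscreteGeometry.IsTwoShellGood (1 / 20) (47 / 50) 1 x i} : ℝ) ≤ Literature.MathematicalPhysics.StatisticalMechanics.interactionEnergy Literature.MathematicalPhysics.StatisticalMechanics.lennardJones x := by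
  intro N x hN
  have hbad : (Nat.card {i : Fin N // ¬ IsTwoShellGood (1 / 20) (47 / 50) 1 x i} : ℝ) = N := by
    exact_mod_cast CoerciveTwoShellGapNegative.bad_eq_of_le (1 / 20) hN x
  have he : eStar ≤ -(711 / 1000) := OnePercentFccRung.eStar_le_neg
  have hE := neg_le_interactionEnergy x
  have hNr : (N : ℝ) ≤ 18 := by exact_mod_cast hN
  have hN0 : (0 : ℝ) ≤ N := Nat.cast_nonneg N
  show (N : ℝ) * eStar + _ ≤ _
  rw [hbad]
  nlinarith [mul_le_mul_of_nonneg_left he hN0]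

end Summit.AtomisticToContinuum.Crystallization.Theorems.NashTwoShellGapSmallClusterGap

end
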